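import Summits.ABC.ABC.Theorems.DefiniteXiFreyModularityStubAbsIrrNegThree
import Literature.NumberTheory.EllipticCurves.SerreOpenImageSupersingularFrobeniusProofs
import Literature.NumberTheory.Automorphic.LanglandsTunnellModThree
import Literature.NumberTheory.Automorphic.TunnellOctahedralGlobal
import Literature.NumberTheory.Automorphic.CDTTheorem722
import Literature.NumberTheory.Automorphic.BCDTTheoremB
import Literature.NumberTheory.GaloisRepresentations.IntegralGaloisAction
import HarnessLib

/-!
# Stub ideas, `stub_modThree`, ideator k = 3, GENERATION 5 — "PIN AT v = 3"

Companion to `STUB-IDEAS-stub_modThree-3.md` (generation 5).  Home family 3 (probe the extremes).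
Generation 4 (this ideator) typed the general LOCAL PIN: Langlands' quadratic descent over
`K = ℚ(√-3)` (the field of `det ρ̄ = χ̄₃`) is rigid — no `tunnell_lemma` — as soon as `σ = Ψ ∘ ρ̄` is
irreducible on a decomposition group at ONE place that does not split in `K`.  Generation 5 takes
the extreme place: **`v = 3` itself**, the only place RAMIFIED in `K`, hence non-split for free, and
the one place where the Frey family is uniform:

* `3 ∤ abc` ⇒ `E_(a,b)` has good SUPERSINGULAR reduction `y² = x³ - x` at `3` (tree:
  `frobeniusTrace_three_smul_freyCurve`), so `ρ̄(I₃) = C₈` (non-split Cartan, tree: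
  `isCyclic_and_card_inertia_map_of_dvd_frobeniusTrace`) and `ρ̄(Frob₃)` acts on it by `x ↦ x³`
  (tree: `conj_frob_smul_kummer`, `galoisRepTorsion_not_mem_map_inertia_of_isArithFrobAt`): the pin
  at `3` is the tree's own Serre-Prop.-12 computation, minus one line (N1 below);
* `3 ∣ abc` ⇒ `E_(a,b)` is a Tate curve at `3` up to unramified twist, pinned iff its Tate parameter
  is not a cube (N3); and the SHARPENED SWITCH (SW₃) — Wiles' auxiliary curve `E_t` of Rubin's
  explicit family `X_E(5) ≅ ℙ¹` chosen `3`-adically close to the Tate point `q' = 3⁵ q_E` (Rubin's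
  switch avoids a FINITE set of `t` by Faltings, so `3`-adic density of `ℚ` suffices; BCDT §2.2 and
  BDST 2001 impose local conditions on the auxiliary curve the same way) — makes the switched
  curve pinned at `3` whenever the Frey curve is not.

Consequence typed here (kernel-checked): on the Frey line the stub is only ever CONSUMED on `ρ̄`
pinned at `3` (`isModular_freyCurve_of_pinnedStubs`), and the pinned stub is closed
(`sigPinned_of_cells`) from Langlands' tetrahedral theorem + cyclic descent (tree leaves), the new
named fact (P₃) = quadratic base change compatibility at ONE ODD non-split place, the weight-one
package (F4), and the dihedral branch.  Langlands–Tunnell proper (Tunnell 1981, `tunnell_lemma`,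
the octahedral descent) and generation 4's residual `R_T` DISAPPEAR from the line.
Sorries only in the helper stubs marked `:= by sorry`.
-/

-- `Summit.<Summit>.<Problem>` doubles `ABC` deliberately (CONVENTIONS §2).
set_option linter.dupNamespace false

noncomputable section

open scoped MatrixGroups NumberField Polynomial Classical Pointwise
open NumberField IsDedekindDomain Field Polynomial Filter Matrix
open Literature.NumberTheory.EllipticCurves
open Literature.NumberTheory.GaloisRepresentations Literature.NumberTheory.Automorphic
open Literature.NumberTheory.Automorphic.BCDT
open WeierstrassCurve

namespace Summit.ABC.ABC.Cruxes.FreyModularity.StubIdeasModThree3G5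

/-! ### The stub, verbatim, and its PINNED form -/

/-- The registered stub's signature (`Lines/Sketch.lean`, `stub_modThree`), verbatim. -/
abbrev SigStubModThree : Prop :=
  ∀ (W : WeierstrassCurve ℚ) [W.IsElliptic] (ρ : ModPGaloisRep ℚ (ZMod 3) 2),
    W.IsTorsionGaloisRep 3 ρ → FramedRep.IsAbsolutelyIrreducible ρ → ρ.IsModular

/-- The finite place of `ℚ` attached to a rational prime (generation 4, verbatim). -/
def placeOfPrime (p : ℕ) (hp : p.Prime) : HeightOneSpectrum (𝓞 ℚ) :=
  Rat.HeightOneSpectrum.primesEquiv.symm ⟨p, hp⟩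

/-- **`ρ̄(D_p)` is non-abelian** (generation 4, verbatim): two elements of a decomposition group
above `p` whose images do not commute; for `σ = Ψ ∘ ρ̄` this is `σ|_{D_p}` IRREDUCIBLE. -/
def HasNonabelianDecompositionAt (ρ : ModPGaloisRep ℚ (ZMod 3) 2) (p : ℕ) (hp : p.Prime) : Prop :=
  ∃ 𝔔 ∈ (placeOfPrime p hp).primesAbove,
    ∃ τ₁ ∈ 𝔔.decompositionSubgroup (Field.absoluteGaloisGroup ℚ),
      ∃ τ₂ ∈ 𝔔.decompositionSubgroup (Field.absoluteGaloisGroup ℚ), ρ τ₁ * ρ τ₂ ≠ ρ τ₂ * ρ τ₁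

/-- **THE PIN AT `3`**: `ρ̄(D₃)` is non-abelian.  (`3` ramifies in `ℚ(√-3)`, so the non-split half
of generation 4's `HasLocalPin` is automatic.) -/
abbrev HasPinAtThree (ρ : ModPGaloisRep ℚ (ZMod 3) 2) : Prop :=
  HasNonabelianDecompositionAt ρ 3 Nat.prime_three

/-- **The PINNED stub**: `stub_modThree` with the extra hypothesis `HasPinAtThree ρ̄`.  This is all
the Frey line consumes (`isModular_freyCurve_of_pinnedStubs`). -/
abbrev SigStubModThreePinned : Prop :=
  ∀ (W : WeierstrassCurve ℚ) [W.IsElliptic] (ρ : ModPGaloisRep ℚ (ZMod 3) 2),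
    W.IsTorsionGaloisRep 3 ρ → FramedRep.IsAbsolutelyIrreducible ρ → HasPinAtThree ρ → ρ.IsModular

/-! ### N1–N3: when is `ρ̄ = E[3]` pinned at `3`? -/

/-- **(N1a) Serre Prop. 12 d) as NON-COMMUTATION, `S`** (Literature-side helper, any odd `ℓ`):
at an odd prime `ℓ` of good supersingular reduction of the minimal `E/ℚ`, some Frobenius `φ ∈ D_𝔓`
and some `s ∈ I_𝔓` have non-commuting images on `E[ℓ]`.  This is the tree's
`galoisRepTorsion_not_mem_map_inertia_of_isArithFrobAt` with ONE step removed: that proof derives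
`False` from `hcomm : ρ φ * ρ s₀ = ρ s₀ * ρ φ` for the Kummer generator `s₀` (`u = s₀⁻¹ φ s₀ φ⁻¹`
acts trivially on `E[ℓ]` hence on `π = ℓ^{1/(ℓ²-1)}`, but `u π = ζ^{ℓ-1} π`); here `hcomm` is the
hypothesis to refute, so the refactor is verbatim. [cite: Serre1972, §1.11 Prop. 12 c), d) (p. 275)] -/
theorem exists_frob_inertia_not_commute (ℓ : ℕ) [Fact ℓ.Prime] {W : WeierstrassCurve ℚ}
    [W.IsGloballyMinimal] [W.IsElliptic] (hΔ : ¬ (ℓ : ℤ) ∣ minimalDiscriminantInt W)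
    (hss : (ℓ : ℤ) ∣ W.frobeniusTrace ℓ) (hℓ2 : ℓ ≠ 2) {v₀ : HeightOneSpectrum (𝓞 ℚ)}
    (hvℓ : (Rat.HeightOneSpectrum.primesEquiv v₀ : ℕ) = ℓ) :
    ∃ 𝔓 ∈ v₀.primesAbove, ∃ φ ∈ MulAction.stabilizer (absoluteGaloisGroup ℚ) 𝔓,
      ∃ s ∈ 𝔓.inertia (absoluteGaloisGroup ℚ),
        galoisRepTorsion W ℓ φ * galoisRepTorsion W ℓ s ≠
          galoisRepTorsion W ℓ s * galoisRepTorsion W ℓ φ := by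
  sorry

/-- **(N1) supersingular at `3` ⇒ pinned at `3`, `S`.**  From N1a at `ℓ = 3` (`I_𝔓 ≤ D_𝔓`:
`Ideal.inertia_le_stabilizer`; `D_𝔓 = 𝔓.decompositionSubgroup = MulAction.stabilizer`) transported
to the frame: `ρ (φ s φ⁻¹ s⁻¹) = 1 ↔ galoisRepTorsion W 3 (φ s φ⁻¹ s⁻¹) = 1`, both saying the
commutator fixes `E[3]` pointwise (`galoisRepTorsion_eq_one_iff'`, `eq_one_of_forall_smul_eq`, as
in the tree's `exists_orderOf_eq_eight_of_dvd_frobeniusTrace`). [cite: Serre1972, §1.11 Prop. 12] -/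
theorem hasPinAtThree_of_supersingular (W : WeierstrassCurve ℚ) [W.IsGloballyMinimal]
    [W.IsElliptic] (hΔ : ¬ ((3 : ℕ) : ℤ) ∣ minimalDiscriminantInt W)
    (hss : ((3 : ℕ) : ℤ) ∣ W.frobeniusTrace 3) {ρ : ModPGaloisRep ℚ (ZMod 3) 2}
    (hρ : W.IsTorsionGaloisRep 3 ρ) : HasPinAtThree ρ := by
  sorry

/-- **(T) framed `E[n]` along `E ≅ C • E`, `S` — IN THE TREE TWICE** (public
`Summit.ABC.ABC.Theorems.isTorsionGaloisRep_of_isogeny_bijective` in `…StubAbsIrrSqrtFiveLocal`, whose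
module is outside this file's import closure on the farm snapshot, and a private copy in
`…StubAbsIrrNegThree`): cite it, nothing to prove. [folklore] -/
theorem isTorsionGaloisRep_smul (W : WeierstrassCurve ℚ) [W.IsElliptic] (C : VariableChange ℚ)
    {n : ℕ} {ρ : FramedGaloisRep ℚ (ZMod n) 2} (h : W.IsTorsionGaloisRep n ρ) :
    (C • W).IsTorsionGaloisRep n ρ := by
  sorry

/-- **(N2) every Frey curve with `3 ∤ abc` is pinned at `3`** (kernel-checked from N1 + T): the global
minimal model `C • E_(a,b)` has good supersingular reduction at `3` with `a₃ = 0` (tree: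
`frobeniusTrace_three_smul_freyCurve`), the same `E[3]` (`isTorsionGaloisRep_of_isogeny_bijective`),
and `HasPinAtThree` is a property of `ρ̄` alone. [cite: Serre1972, §1.11 Prop. 12 c)] -/
theorem hasPinAtThree_freyCurve_of_not_three_dvd {a b : ℤ} (h0 : a * b * (a + b) ≠ 0)
    (h3 : ¬ (3 : ℤ) ∣ a * b * (a + b)) {ρ : ModPGaloisRep ℚ (ZMod 3) 2}
    (hρ : (freyCurve a b).IsTorsionGaloisRep 3 ρ) : HasPinAtThree ρ := by
  haveI := isElliptic_freyCurve h0
  obtain ⟨C, hC⟩ := hasGlobalMinimalModel_rat_holds (freyCurve a b)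
  haveI := hC
  obtain ⟨hgood, htr⟩ := Summit.ABC.ABC.Theorems.frobeniusTrace_three_smul_freyCurve h0 h3 C
  have hΔ :=
    (C • freyCurve a b).not_dvd_minimalDiscriminantInt_of_hasGoodReductionAtPrime' 3 hgood
  have hρ' : (C • freyCurve a b).IsTorsionGaloisRep 3 ρ := isTorsionGaloisRep_smul (freyCurve a b) C hρ
  have hss : ((3 : ℕ) : ℤ) ∣ (C • freyCurve a b).frobeniusTrace 3 := by
    rw [htr]; exact dvd_zero _
  exact hasPinAtThree_of_supersingular (C • freyCurve a b) hΔ hss hρ'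

/-- **(N3) Tate non-cube at `3` ⇒ pinned at `3`, `M`** (generation 4's L2 at `p = 3`).  `E`
potentially multiplicative at `3` (`v₃(j) < 0`): over `ℚ₃`, `E ≅ E_q ⊗ δ` with `v₃(q) = -v₃(j)`,
`ℚ₃(E_q[3]) = ℚ₃(ζ₃, q^{1/3})`; if `3 ∤ v₃(j)` then `q ∉ (ℚ₃^×)³` (indeed `∉ (ℚ₃(ζ₃)^×)³`: norms), so
`ρ̄(D₃) = (χ̄₃ *; 0 1)` of order `6 ≅ S₃`, non-abelian; the twist `δ` is central.  (Exact criterion: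
`q` not a cube, i.e. NOT (`3 ∣ v₃(q)` and `q 3^{-v₃(q)} ≡ ±1 (mod 9)`); `3 ∤ v₃(j)` is the part SW₃
can force.) [cite: Serre1972, §1.12 and Appendix A.1; SilvermanATAEC1994, V.5–V.6] -/
theorem hasPinAtThree_of_tate_not_cube (W : WeierstrassCurve ℚ) [W.IsElliptic]
    (ρ : ModPGaloisRep ℚ (ZMod 3) 2) (hρ : W.IsTorsionGaloisRep 3 ρ)
    (hj : padicValRat 3 W.j < 0) (hcube : ¬ (3 : ℤ) ∣ padicValRat 3 W.j) : HasPinAtThree ρ := by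
  sorry

/-- **(J1) Frey curves with `3 ∣ abc` are potentially multiplicative at `3`, `S`**:
`j = 2⁸ (a² + ab + b²)³ / (ab(a+b))²` (tree: `j_freyCurve`, `DenesEquationLargeExponentsProofs`) and
`3 ∤ a² + ab + b²` when `3` divides exactly one of the coprime `a, b, a + b`, so
`v₃(j) = -2 v₃(abc) < 0`. [cite: Serre1987, §4.1 (4.1.9)] -/
theorem padicValRat_three_j_freyCurve_neg {a b : ℤ} (hab : IsCoprime a b)
    (h0 : a * b * (a + b) ≠ 0) (h3 : (3 : ℤ) ∣ a * b * (a + b)) :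
    haveI := isElliptic_freyCurve h0
    padicValRat 3 (freyCurve a b).j < 0 := by
  sorry

/-! ### SW₃ — the sharpened switch: the auxiliary curve is a Tate non-cube at `3` -/

/-- **(SW₃) NEW NAMED FACT — Wiles' `3`–`5` switch with a `3`-adic condition on `j`.**  For `E/ℚ`
potentially multiplicative at `3` (`v₃(j_E) < 0`) with `27 ∤ N_E` and a framed model `ρ̄` of `E[5]`
absolutely irreducible over `ℚ(√5)`, there is `E'/ℚ` with `E'[5] ≅ E[5]` (same frame),
`ρ̄_{E',3}|_{ℚ(√-3)}` absolutely irreducible, `E'` potentially multiplicative at `3` AND `3 ∤ v₃(j_{E'})`.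
Compared with the tree's `BCDT.CDT_three_five_switch` (= the registered `stub_switch`): the case-B
hypothesis is DROPPED (it is never used in print) and the `3`-adic clause is ADDED.  Proof in print
(Rubin, *Modularity of mod 5 representations*, in Cornell–Silverman–Stevens 1997, Prop. 11, Lemma 12
and §4, pp. 559–560 of the volume's PDF): `ψ : ℙ¹ ≅ X_E` over `ℚ` and the family
`E_t : y² = x³ + f_E(t) x + g_E(t)` with `ρ̄_{E_t,5} ≅ ρ̄_{E,5}` symplectically for `t ∉` a finite set;
the `t` with `ρ̄_{E_t,3}|_{ℚ(√-3)}` NOT absolutely irreducible come from `Y'_E(ℚ) ∪ Y''_E(ℚ)`, FINITE by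
Faltings (genus `> 1`, Lemma 12) — so every `t ∈ ℚ` off a finite set `T` works, and NO Hilbert
irreducibility is needed.  The `3`-adic clause: over `ℚ₃`, `E ≅ E_q ⊗ δ` (Tate), and `E_{q'} ⊗ δ` with
`q' = 3⁵ q` or `3^{10} q` has `E_{q'}[5] ≅ E_q[5]` symplectically (`q'/q ∈ (ℚ₃^×)⁵`: same Kummer class
of `0 → μ₅ → E_q[5] → ℤ/5 → 0`, Weil pairing `e₅(ζ, q^{1/5}) = ζ`), so `[E_{q'} ⊗ δ] = ψ(t₃) ∈ X_E(ℚ₃)`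
with `3 ∤ v₃(q') = -v₃(j)`; `v₃ ∘ j ∘ ψ` is locally constant at `t₃` (a rational function, finite
non-zero value), and `ℚ ∖ T` is dense in `ℚ₃`.  (BCDT 2001 §2.2, third step, and
Buzzard–Dickinson–Shepherd-Barron–Taylor 2001, p. 7, impose local conditions on the auxiliary curve
in exactly this way, there with Ekedahl's Hilbert irreducibility because surjectivity mod `3` is
wanted; here absolute irreducibility over `ℚ(√-3)` suffices and Faltings replaces HIT, as in Rubin.)
[cite: RubinCSS1997, Prop. 11, Lemma 12, §4 (proof of Thm. 2)] [cite: BCDTJAMS2001, §2.2 (proof of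
Thm. 2.2.1, third step)] [cite: BDST2001Duke, p. 7 of doi:10.1215/s0012-7094-01-10922-8]
[cite: SilvermanATAEC1994, V.3, V.5] -/
def SwitchTateAtThree : Prop :=
  ∀ (W : WeierstrassCurve ℚ) [W.IsElliptic], padicValRat 3 W.j < 0 → ¬ 27 ∣ W.conductorNorm ℤ →
    ∀ (ρ : ModPGaloisRep ℚ (ZMod 5) 2), W.IsTorsionGaloisRep 5 ρ → ρ.IsAbsIrreducibleOverSqrt 5 →
      ∃ (W' : WeierstrassCurve ℚ) (_ : W'.IsElliptic), W'.IsTorsionGaloisRep 5 ρ ∧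
        padicValRat 3 W'.j < 0 ∧ ¬ (3 : ℤ) ∣ padicValRat 3 W'.j ∧
        ∃ ρ₃' : ModPGaloisRep ℚ (ZMod 3) 2, W'.IsTorsionGaloisRep 3 ρ₃' ∧
          ρ₃'.IsAbsIrreducibleOverSqrt (-3)

/-- Sanity (kernel-checked): on curves potentially multiplicative at `3`, SW₃ implies the registered
`stub_switch` (= `BCDT.CDT_three_five_switch`) — forget the `3`-adic clause, ignore the case-B
hypothesis. [folklore] -/
theorem stub_switch_of_switchTateAtThree (h : SwitchTateAtThree) :
    ∀ (W : WeierstrassCurve ℚ) [W.IsElliptic], padicValRat 3 W.j < 0 → ¬ 27 ∣ W.conductorNorm ℤ →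
      (∀ ρ₃ : ModPGaloisRep ℚ (ZMod 3) 2, W.IsTorsionGaloisRep 3 ρ₃ →
        ¬ ρ₃.IsAbsIrreducibleOverSqrt (-3)) →
      ∀ (ρ : ModPGaloisRep ℚ (ZMod 5) 2), W.IsTorsionGaloisRep 5 ρ → ρ.IsAbsIrreducibleOverSqrt 5 →
      ∃ (W' : WeierstrassCurve ℚ) (_ : W'.IsElliptic), W'.IsTorsionGaloisRep 5 ρ ∧
        ∃ ρ₃' : ModPGaloisRep ℚ (ZMod 3) 2, W'.IsTorsionGaloisRep 3 ρ₃' ∧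
          ρ₃'.IsAbsIrreducibleOverSqrt (-3) := by
  intro W _ hj h27 _ ρ hρ h5
  obtain ⟨W', hW', hρ', -, -, ρ₃', hρ₃', h3i'⟩ := h W hj h27 ρ hρ h5
  exact ⟨W', hW', hρ', ρ₃', hρ₃', h3i'⟩

/-! ### LINE LEVEL (kernel-checked): the Frey line consumes only the PINNED stub -/

/-- `liftThree_of_stubs` of the skeleton, fed with the PINNED stub: modularity of curves semistable
at `3` whose framed `E[3]` is absolutely irreducible over `ℚ(√-3)` AND pinned at `3`. [folklore] -/
theorem liftThree_of_pinnedStubs (hmod3 : SigStubModThreePinned)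
    (hlift3 : ∀ (W : WeierstrassCurve ℚ) [W.IsElliptic] (ρ : ModPGaloisRep ℚ (ZMod 3) 2),
      W.IsTorsionGaloisRep 3 ρ → ρ.IsAbsIrreducibleOverSqrt (-3) → ¬ 9 ∣ W.conductorNorm ℤ →
      ρ.IsModular → W.IsModularGaloisRepTate 3)
    (h32 : ∀ (W : WeierstrassCurve ℚ) [W.IsElliptic] [NeZero (W.conductorNorm ℤ)] (ℓ : ℕ)
      [Fact ℓ.Prime], W.IsModularGaloisRepTate ℓ → BCDT.IsModular W) :
    ∀ (W : WeierstrassCurve ℚ) [W.IsElliptic] [NeZero (W.conductorNorm ℤ)]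
      (ρ : ModPGaloisRep ℚ (ZMod 3) 2), W.IsTorsionGaloisRep 3 ρ →
      ρ.IsAbsIrreducibleOverSqrt (-3) → HasPinAtThree ρ → ¬ 9 ∣ W.conductorNorm ℤ →
      BCDT.IsModular W :=
  fun W _ _ ρ hρ hirr hpin h9 ↦
    h32 W 3 (hlift3 W ρ hρ hirr h9 (hmod3 W ρ hρ hirr.isAbsolutelyIrreducible hpin))

/-- **EVERY FREY CURVE IS MODULAR FROM THE PINNED STUB** — the skeleton's
`isModular_freyCurve_of_stubs` re-routed (kernel-checked).  Three ways in: (i) some framed `E[3]`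
is absolutely irreducible over `ℚ(√-3)` and pinned at `3` — in particular EVERY Frey curve with
`3 ∤ abc` (N2 + the landed R3 stub `isAbsIrreducibleOverSqrt_negThree_freyCurve_of_not_three_dvd`),
and those with `3 ∣ abc`, case A, Tate non-cube (N3); (ii) otherwise `3 ∣ abc`, `v₃(j) < 0` (J1), and
the sharpened switch SW₃ — usable in case A as well as case B, since unlike `CDT_three_five_switch`
it has no case-B hypothesis — hands over `W'` with `W'[5] ≅ E[5]`, `ρ̄_{W',3}|_{ℚ(√-3)}` absolutely
irreducible and `W'` PINNED AT `3` (N3), semistable at `3` by `stub_nineTransfer` (`h6`); then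
`ρ̄_{E,5}` is modular and
the lifting theorem at `5` (`h2`) finishes.  Inputs `h2, h4a, h4b, h6, h25` are the skeleton's,
unchanged (all but `h2` landed). [cite: ConradDiamondTaylor1999, Thm. 7.1.2 (proof, p. 556)] -/
theorem isModular_freyCurve_of_pinnedStubs
    (h1 : ∀ (W : WeierstrassCurve ℚ) [W.IsElliptic] [NeZero (W.conductorNorm ℤ)]
      (ρ : ModPGaloisRep ℚ (ZMod 3) 2), W.IsTorsionGaloisRep 3 ρ →
      ρ.IsAbsIrreducibleOverSqrt (-3) → HasPinAtThree ρ → ¬ 9 ∣ W.conductorNorm ℤ →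
      BCDT.IsModular W)
    (h2 : ∀ (W : WeierstrassCurve ℚ) [W.IsElliptic] [NeZero (W.conductorNorm ℤ)],
      ¬ 25 ∣ W.conductorNorm ℤ →
      ∀ (ρ : ModPGaloisRep ℚ (ZMod 5) 2), W.IsTorsionGaloisRep 5 ρ →
      ρ.IsAbsIrreducibleOverSqrt 5 → ρ.IsModular → BCDT.IsModular W)
    (hSW : SwitchTateAtThree)
    (h4a : ∀ a b : ℤ, IsCoprime a b → a * b * (a + b) ≠ 0 →
      ∀ ρ : ModPGaloisRep ℚ (ZMod 5) 2, (freyCurve a b).IsTorsionGaloisRep 5 ρ →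
        FramedRep.IsIrreducible ρ)
    (h4b : ∀ (W : WeierstrassCurve ℚ) [W.IsElliptic], ¬ 25 ∣ W.conductorNorm ℤ →
      ∀ ρ : ModPGaloisRep ℚ (ZMod 5) 2, W.IsTorsionGaloisRep 5 ρ →
        FramedRep.IsIrreducible ρ → ρ.IsAbsIrreducibleOverSqrt 5)
    (h6 : ∀ (W W' : WeierstrassCurve ℚ) [W.IsElliptic] [W'.IsElliptic]
      (ρ : ModPGaloisRep ℚ (ZMod 5) 2),
      W.IsTorsionGaloisRep 5 ρ → W'.IsTorsionGaloisRep 5 ρ →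
      ¬ 9 ∣ W.conductorNorm ℤ → ¬ 9 ∣ W'.conductorNorm ℤ)
    (h25 : ∀ a b : ℤ, IsCoprime a b → a * b * (a + b) ≠ 0 →
      ¬ 25 ∣ (freyCurve a b).conductorNorm ℤ)
    (hN2 : ∀ a b : ℤ, a * b * (a + b) ≠ 0 → ¬ (3 : ℤ) ∣ a * b * (a + b) →
      ∀ ρ : ModPGaloisRep ℚ (ZMod 3) 2, (freyCurve a b).IsTorsionGaloisRep 3 ρ → HasPinAtThree ρ)
    (hN3 : ∀ (W : WeierstrassCurve ℚ) [W.IsElliptic] (ρ : ModPGaloisRep ℚ (ZMod 3) 2),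
      W.IsTorsionGaloisRep 3 ρ → padicValRat 3 W.j < 0 → ¬ (3 : ℤ) ∣ padicValRat 3 W.j →
      HasPinAtThree ρ)
    (hJ : ∀ (a b : ℤ) [(freyCurve a b).IsElliptic], IsCoprime a b → a * b * (a + b) ≠ 0 →
      (3 : ℤ) ∣ a * b * (a + b) → padicValRat 3 (freyCurve a b).j < 0)
    {a b : ℤ} (hab : IsCoprime a b) (h0 : a * b * (a + b) ≠ 0)
    [NeZero ((freyCurve a b).conductorNorm ℤ)] : BCDT.IsModular (freyCurve a b) := by
  haveI := isElliptic_freyCurve h0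
  haveI : NeZero ((3 : ℕ) : ℚ) := ⟨by norm_num⟩
  have h9 : ¬ 9 ∣ (freyCurve a b).conductorNorm ℤ :=
    Summit.ABC.ABC.Theorems.not_nine_dvd_conductorNorm_freyCurve hab h0
  have h25' : ¬ 25 ∣ (freyCurve a b).conductorNorm ℤ := h25 a b hab h0
  -- (i) pinned case A: a framed `E[3]` absolutely irreducible over `ℚ(√-3)` and pinned at `3`
  by_cases hA : ∃ ρ₃ : ModPGaloisRep ℚ (ZMod 3) 2, (freyCurve a b).IsTorsionGaloisRep 3 ρ₃ ∧
      ρ₃.IsAbsIrreducibleOverSqrt (-3) ∧ HasPinAtThree ρ₃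
  · obtain ⟨ρ₃, hρ₃, h3i, hpin⟩ := hA
    exact h1 (freyCurve a b) ρ₃ hρ₃ h3i hpin h9
  -- otherwise `3 ∣ abc`: for `3 ∤ abc` every framed `E[3]` is in the pinned case A (N2 + R3)
  have h3 : (3 : ℤ) ∣ a * b * (a + b) := by
    by_contra h3
    obtain ⟨ρ₃, hρ₃⟩ := (freyCurve a b).exists_isTorsionGaloisRep 3
    exact hA ⟨ρ₃, hρ₃,
      Summit.ABC.ABC.Theorems.isAbsIrreducibleOverSqrt_negThree_freyCurve_of_not_three_dvd
        a b hab h0 h3 ρ₃ hρ₃, hN2 a b h0 h3 ρ₃ hρ₃⟩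
  have hj : padicValRat 3 (freyCurve a b).j < 0 := hJ a b hab h0 h3
  -- (ii) work at `5`: `ρ̄_{E,5}` irreducible, absolutely irreducible over `ℚ(√5)`, `det = χ̄₅`
  obtain ⟨ρ, hρ⟩ := (freyCurve a b).exists_isTorsionGaloisRep 5
  have hirr : FramedRep.IsIrreducible ρ := h4a a b hab h0 ρ hρ
  have h5 : ρ.IsAbsIrreducibleOverSqrt 5 := h4b (freyCurve a b) h25' ρ hρ hirr
  have h27 : ¬ 27 ∣ (freyCurve a b).conductorNorm ℤ := fun h27 ↦ h9 (dvd_trans ⟨3, rfl⟩ h27)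
  -- the sharpened switch: `W'` with `W'[5] ≅ E[5]`, Tate non-cube at `3`, `ρ̄_{W',3}|ℚ(√-3)` abs. irr.
  obtain ⟨W', hW', hρ', hj', hcube', ρ₃', hρ₃', h3i'⟩ := hSW (freyCurve a b) hj h27 ρ hρ h5
  haveI := hW'
  haveI : NeZero (W'.conductorNorm ℤ) := ⟨(conductorNorm_pos_holds W').ne'⟩
  have h9' : ¬ 9 ∣ W'.conductorNorm ℤ := h6 (freyCurve a b) W' ρ hρ hρ' h9
  -- `W'` is modular by the PINNED road at `3`
  have hE' : BCDT.IsModular W' := h1 W' ρ₃' hρ₃' h3i' (hN3 W' ρ₃' hρ₃' hj' hcube') h9'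
  -- so `ρ̄_{E,5} = ρ̄_{W',5}` is modular and `E` is modular by the lifting theorem at `5`
  have hρmod : ρ.IsModular := hE'.isModular_of_isTorsionGaloisRep'' hρ'
  exact h2 (freyCurve a b) h25' ρ hρ h5 hρmod

/-! ### STUB LEVEL: closing the pinned stub — descent pinned at ONE ODD place -/

/-- `σ|_{D_𝔓}` has no invariant line (generation 4, verbatim). -/
def NoDecompositionInvariantLine {F : Type} [Field F] [NumberField F] (σ : FramedArtinRep F 2)
    (𝔓 : Ideal (absIntegers (𝓞 F) F)) : Prop :=
  ¬ ∃ v : Fin 2 → ℂ, v ≠ 0 ∧ ∀ τ ∈ 𝔓.decompositionSubgroup (Field.absoluteGaloisGroup F),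
      ∃ c : ℂ, ((σ τ : GL (Fin 2) ℂ) : Matrix (Fin 2) (Fin 2) ℂ).mulVec v = c • v

/-- The finite place `v` of `F` does not split in `E` (generation 4, verbatim). -/
def IsNonsplitIn {F : Type} [Field F] [NumberField F] (E : Type) [Field E] [NumberField E]
    [Algebra F E] (v : HeightOneSpectrum (𝓞 F)) : Prop :=
  ∀ w w' : HeightOneSpectrum (𝓞 E),
    w.asIdeal.under (𝓞 F) = v.asIdeal → w'.asIdeal.under (𝓞 F) = v.asIdeal → w = w'

/-- **An ODD decomposition pin for `σ` along `E/F`**: a finite place `v ∤ 2` of `F`, non-split in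
`E`, above which `σ` is irreducible on the decomposition group.  (Generation 4's
`HasDecompositionPin` without the parity clause; at `v ∤ 2` every irreducible `σ_v` is INDUCED —
no primitive `2`-dimensional representations of `W_{F_v}` in odd residue characteristic — so the
local dictionary needed downstream is the tame/dihedral one only.) -/
def HasOddDecompositionPin {F : Type} [Field F] [NumberField F] (E : Type) [Field E]
    [NumberField E] [Algebra F E] (σ : FramedArtinRep F 2) : Prop :=
  ∃ v : HeightOneSpectrum (𝓞 F), IsNonsplitIn E v ∧ (2 : 𝓞 F) ∉ v.asIdeal ∧
    ∃ 𝔓 ∈ v.primesAbove, NoDecompositionInvariantLine σ 𝔓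

/-- "The central character of `π` is `det σ`", a.e. Satake form (generations 4 of k = 2 / k = 3,
verbatim). -/
def CentralCharIsDet {F : Type} [Field F] [NumberField F] (σ : FramedArtinRep F 2)
    {hF : isCompact_glFiniteIntegralLevel 2 F} (π : AutomorphicRepData (AutomorphyDatum.gl 2 F hF)) :
    Prop :=
  ∀ᶠ u : HeightOneSpectrum (𝓞 F) in Filter.cofinite, ∀ α : Multiset ℂ, π.HasSatakeParamAt u α →
    ∀ 𝔓 ∈ u.primesAbove, ∀ τ : Field.absoluteGaloisGroup F, IsArithFrobAt (𝓞 F) τ 𝔓 →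
      α.prod = ((Matrix.GeneralLinearGroup.det (σ τ) : ℂˣ) : ℂ)

/-- **(P₃) NEW NAMED FACT — quadratic descent pinned at ONE ODD non-split place.**  `E/F`
quadratic, `σ : Γ_F → GL₂(ℂ)` with `σ_E` irreducible and `Π_E = π(σ_E)` cuspidal, `π` cuspidal on
`GL₂(𝔸_F)` with weak base change `Π_E`; if some non-split `v ∤ 2` has `σ|_{D_v}` irreducible then
`ω_π = det σ` (a.e. Satake form).  Proof in print: base change `BC_{E/F}` is defined and proved AT
EVERY PLACE at the level of Langlands parameters ("`Π` is a base change lift of `π` if for each place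
`v` of `F`, and `w | v`, the Langlands parameter attached to `Π_w` equals the restriction to `W_{E_w}`
of the Langlands parameter `σ_v` of `π_v`" — Gelbart, Definition p. 248; Theorem (a)(b) p. 250 after
[La1]: existence/uniqueness of the lift, fibres `= {π, π ⊗ ω_{E/F}}`); by strong multiplicity one
`Π_E ≅ ⊗_w π(σ_E|_{W_{E_w}})`; at the pin, `[E_w : F_v] = 2`, `σ_v` irreducible on `W_{F_v}` hence
(`v ∤ 2`) `σ_v = Ind θ`, and `φ_{π_v}|_{W_{E_w}} ≅ σ_v|_{W_{E_w}}` forces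
`φ_{π_v} ∈ {σ_v, σ_v ⊗ η_v}` (Clifford, index `2`; one point if `θ` lives on `E_w` itself), so
`ω_{π,v} = det σ_v`; globally `ω_π (det σ)⁻¹ ∈ {1, η_{E/F}}` (trivial on norms) and `η_{E/F,v} ≠ 1`
at the non-split `v`.  Odd-place-only version of generation 4's (P); its local dictionary is
Jacquet–Langlands' `π(Ind θ)` (Weil representation) and the explicit local quadratic base change of
induced/principal-series representations (Cognet 1985).  No `tunnell_lemma`, no non-normal cubic
base change, no `LLC(GL₂(ℚ₂))`. [cite: Gelbart1997, §6.1 Definition (p. 248), Theorem (a)(b) (p. 250)]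
[cite: LanglandsBaseChange1980, §§2, 7, 11] [cite: Cognet1985BSMF, pp. 403–404, 448–457]
[cite: ArthurClozelAMS120, Ch. 3 Thm. 4.2, Thm. 5.1] -/
def quadraticDescent_centralCharacter_oddPin : Prop :=
  ∀ (F E : Type) [Field F] [NumberField F] [Field E] [NumberField E] [Algebra F E],
    Module.finrank F E = 2 →
    ∀ (σ : FramedArtinRep F 2) (hF : isCompact_glFiniteIntegralLevel 2 F)
      (hE : isCompact_glFiniteIntegralLevel 2 E) (PE : CuspidalAutomorphicRepData 2 E hE)
      (π : CuspidalAutomorphicRepData 2 F hF),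
      (σ.restrictField E).toGaloisRep.IsIrreducible →
      IsPiOfArtinRep (σ.restrictField E) PE.1 → IsWeakBaseChangeLiftAE π.1 PE.1 →
      HasOddDecompositionPin E σ → CentralCharIsDet σ π.1

/-- **(F4) weight one from a pinned descent** (k = 2's named helper, verbatim; shared back end).
[cite: DeligneSerreASENS1974, Thm. 4.1] [cite: Gelbart1997, Props. 4.1–4.2] -/
def langlandsTunnell_of_pinnedDescent : Prop :=
  ∀ (E : Type) [Field E] [NumberField E] [Algebra ℚ E], Module.finrank ℚ E = 2 →
    ∀ (σ : FramedArtinRep ℚ 2) (hQ : isCompact_glFiniteIntegralLevel 2 ℚ)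
      (hE : isCompact_glFiniteIntegralLevel 2 E) (PE : CuspidalAutomorphicRepData 2 E hE)
      (π : CuspidalAutomorphicRepData 2 ℚ hQ),
      σ.IsOdd → (σ.restrictField E).toGaloisRep.IsIrreducible →
      IsPiOfArtinRep (σ.restrictField E) PE.1 → IsWeakBaseChangeLiftAE π.1 PE.1 →
      CentralCharIsDet σ π.1 → langlands_tunnell σ

/-- **(L1₃) Galois side of the pin at `3`, `M`.**  Surjective `ρ̄ = E[3]` pinned at `3`:
`E = ℚ(√-3)` (field of `det ρ̄ = χ̄₃`: `det_eq_modPCyclotomicCharacter_of_isTorsionGaloisRep_holds`)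
is quadratic; `σ_E` is tetrahedral irreducible (`ρ̄(Γ_E) = SL₂(𝔽₃)`); the place `3` is RAMIFIED in
`E`, hence non-split, and odd; `σ|_{D₃} = Ψ(ρ̄(D₃))` has no invariant line since an invariant line
makes a `2`-dimensional representation of a finite group a sum of characters (abelian image) while
`Ψ : GL₂(𝔽₃) ↪ GL₂(ℂ)` is injective and `ρ̄(D₃)` is non-abelian. [cite: Serre1972, §1.11] -/
theorem exists_oddDecompositionPin_of_hasPinAtThree
    (W : WeierstrassCurve ℚ) [W.IsElliptic] (ρ : ModPGaloisRep ℚ (ZMod 3) 2)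
    (hρ : W.IsTorsionGaloisRep 3 ρ) (hs : Function.Surjective ρ) (hpin : HasPinAtThree ρ) :
    ∃ (E : Type) (_ : Field E) (_ : NumberField E) (_ : Algebra ℚ E),
      Module.finrank ℚ E = 2 ∧
      ((modThreeLift ρ).restrictField E).toGaloisRep.IsIrreducible ∧
      IsTetrahedralType ((modThreeLift ρ).restrictField E).toMonoidHom ∧
      HasOddDecompositionPin E (modThreeLift ρ) := by
  sorry

/-- **(H2) descent datum, `M`** (k = 2 generation 4, H2, verbatim: `Π_E = π(σ_E)` by the tetrahedral
leaf, `cuspidal_descent_cyclic` for the quadratic `E/ℚ`). -/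
theorem exists_descent_of_isTetrahedralType_restrictField
    (hT : strongArtin_of_isTetrahedralType) (hD : cuspidal_descent_cyclic)
    (hQ : isCompact_glFiniteIntegralLevel 2 ℚ)
    (E : Type) [Field E] [NumberField E] [Algebra ℚ E] (hdeg : Module.finrank ℚ E = 2)
    (σ : FramedArtinRep ℚ 2) (hirr : (σ.restrictField E).toGaloisRep.IsIrreducible)
    (htet : IsTetrahedralType (σ.restrictField E).toMonoidHom) :
    ∃ (hE : isCompact_glFiniteIntegralLevel 2 E) (PE : CuspidalAutomorphicRepData 2 E hE)
      (π : CuspidalAutomorphicRepData 2 ℚ hQ),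
      IsPiOfArtinRep (σ.restrictField E) PE.1 ∧ IsWeakBaseChangeLiftAE π.1 PE.1 := by
  sorry

/-- **(H3) pointwise Langlands–Tunnell ⇒ modular** (PROVED by k = 1, `isModular_of_langlands_tunnell_at`,
0 sorries; restated because crux-dir files are not importable). -/
theorem isModular_of_langlands_tunnell_at (ρ : ModPGaloisRep ℚ (ZMod 3) 2)
    (hLT : langlands_tunnell (modThreeLift ρ)) (habs : FramedRep.IsAbsolutelyIrreducible ρ)
    (hodd : FramedGaloisRep.IsOdd ρ) : ρ.IsModular := by
  sorry

/-- Oddness of `ρ̄ = E[3]` from `det ρ̄ = χ̄₃` (PROVED, generation 4 verbatim). -/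
theorem isOdd_of_isTorsionGaloisRep (W : WeierstrassCurve ℚ) [W.IsElliptic]
    (ρ : ModPGaloisRep ℚ (ZMod 3) 2) (hρ : W.IsTorsionGaloisRep 3 ρ) : FramedGaloisRep.IsOdd ρ := by
  haveI : NeZero ((3 : ℕ) : ℚ) := ⟨by norm_num⟩
  intro φ c hc
  rw [W.det_eq_modPCyclotomicCharacter_of_isTorsionGaloisRep_holds 3 ρ hρ c]
  ext
  rw [modPCyclotomicCharacterZMod_eq_modNCyclotomicCharacter,
    modNCyclotomicCharacter_of_isComplexConjugation hc, Units.val_neg, Units.val_one]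

/-- **The PIN-AT-3 CELL**: surjective `ρ̄ = E[3]` pinned at `3` is modular. -/
def PinAtThreeCell : Prop :=
  ∀ (W : WeierstrassCurve ℚ) [W.IsElliptic] (ρ : ModPGaloisRep ℚ (ZMod 3) 2),
    W.IsTorsionGaloisRep 3 ρ → FramedRep.IsAbsolutelyIrreducible ρ →
    Function.Surjective ρ → HasPinAtThree ρ → ρ.IsModular

/-- **PIN-AT-3 CELL FROM NAMED DEBTS (kernel-checked composition).**  Debts: tree leaves
`strongArtin_of_isTetrahedralType`, `cuspidal_descent_cyclic`; (P₃); (F4); the typing datum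
`isCompact_glFiniteIntegralLevel 2 ℚ`; helper stubs L1₃, H2, H3.  No `tunnell_lemma`. -/
theorem pinAtThreeCell_of_oddPin (hT : strongArtin_of_isTetrahedralType)
    (hD : cuspidal_descent_cyclic) (hP : quadraticDescent_centralCharacter_oddPin)
    (hW : langlandsTunnell_of_pinnedDescent) (hQ : isCompact_glFiniteIntegralLevel 2 ℚ) :
    PinAtThreeCell := by
  intro W _ ρ hρ habs hs hpin
  have hodd : FramedGaloisRep.IsOdd ρ := isOdd_of_isTorsionGaloisRep W ρ hρ
  obtain ⟨E, _, _, _, hdeg, hirr, htet, hdp⟩ :=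
    exists_oddDecompositionPin_of_hasPinAtThree W ρ hρ hs hpin
  obtain ⟨hE, PE, π, hPE, hBC⟩ :=
    exists_descent_of_isTetrahedralType_restrictField hT hD hQ E hdeg (modThreeLift ρ) hirr htet
  have hcc : CentralCharIsDet (modThreeLift ρ) π.1 :=
    hP ℚ E hdeg (modThreeLift ρ) hQ hE PE π hirr hPE hBC hdp
  have hLT : langlands_tunnell (modThreeLift ρ) :=
    hW E hdeg (modThreeLift ρ) hQ hE PE π (isOdd_modThreeLift hodd) hirr hPE hBC hcc
  exact isModular_of_langlands_tunnell_at ρ hLT habs hodd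

/-- **The PINNED stub from two cells (kernel-checked)**: the pin-at-3 cell and the dihedral /
non-surjective branch `hDih` (k = 1 Plan D, k = 2 cell 2: Hecke theta series; images `SD₁₆`,
normaliser of a split Cartan). -/
theorem sigPinned_of_cells
    (hDih : ∀ (W : WeierstrassCurve ℚ) [W.IsElliptic] (ρ : ModPGaloisRep ℚ (ZMod 3) 2),
      W.IsTorsionGaloisRep 3 ρ → FramedRep.IsAbsolutelyIrreducible ρ →
      ¬ Function.Surjective ρ → ρ.IsModular)
    (hCell : PinAtThreeCell) : SigStubModThreePinned := by
  intro W _ ρ hρ habs hpin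
  by_cases hs : Function.Surjective ρ
  · exact hCell W ρ hρ habs hs hpin
  · exact hDih W ρ hρ habs hs

/-- **THE GENERATION-5 PLAN FOR THE STUB AS TYPED (kernel-checked)**: the pinned stub plus
generation 4's cells OFF the pin at `3` (`hOff`: other local pins / Allen road / residual `R_T`,
`StubIdeasModThree3G4.stub_modThree_of_planG4`).  On the Frey line `hOff` is never consumed
(`isModular_freyCurve_of_pinnedStubs`). -/
theorem stub_modThree_of_planG5 (hPinned : SigStubModThreePinned)
    (hOff : ∀ (W : WeierstrassCurve ℚ) [W.IsElliptic] (ρ : ModPGaloisRep ℚ (ZMod 3) 2),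
      W.IsTorsionGaloisRep 3 ρ → FramedRep.IsAbsolutelyIrreducible ρ →
      ¬ HasPinAtThree ρ → ρ.IsModular) :
    SigStubModThree := by
  intro W _ ρ hρ habs
  by_cases hpin : HasPinAtThree ρ
  · exact hPinned W ρ hρ habs hpin
  · exact hOff W ρ hρ habs hpin

/-- Sanity (kernel-checked): the tree's global Langlands–Tunnell fact still closes the pinned stub
(so registering the pinned form loses nothing). -/
theorem sigPinned_of_langlands_tunnell (hLT : ∀ σ : FramedArtinRep ℚ 2, langlands_tunnell σ) :
    SigStubModThreePinned :=
  fun W _ ρ hρ habs _ ↦ W.isModular_of_isTorsionGaloisRep_three_of_langlands_tunnell hLT ρ hρ habs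

end Summit.ABC.ABC.Cruxes.FreyModularity.StubIdeasModThree3G5

end
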